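import Mathlib

/-!
# Hodge-locus census — the BLOCK-KERNEL LEMMA (def-free helper of `stmt-HodgeConjecture-16267`)

Pure linear algebra used in step (3) of the proof of THEOREM 1 (iv) of the cell record
`og81/FERMAT-PAIRS-ALL-DEGREES-g29.md` (pub-hlocus, lead gen 29): if a linear map `f : V → W` sends the vectors of a
basis `b` of `V` into the members of an INDEPENDENT family of subspaces `Q i ≤ W` (one block per basis vector), then
`ker f` is spanned by the basis vectors that `f` kills, so `dim ker f` is their number.  Applied to the pencil
`λΦ + Ψ` on `J_t = ⊕ lines j_(t_Z)` with values in `Q_t = ⊕ multidegree summands`, this is the counting formula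
`e_t(λ) = #{window distributions alive at λ}`.

certified instances and evidence bearing on the general Hodge conjecture; no claim.
-/

namespace Summit.HodgeConjecture.HodgeConjecture.HodgeLocus.Census.BlockKernel

open Module Submodule

variable {K V W ι : Type*} [Field K] [AddCommGroup V] [Module K V] [AddCommGroup W] [Module K W]

/-- The images under `f` of the basis vectors NOT killed by `f` are linearly independent when they lie in independent blocks. -/
theorem linearIndependent_image_of_blocks (b : Basis ι K V) (Q : ι → Submodule K W) (hQ : iSupIndep Q)
    (f : V →ₗ[K] W) (hf : ∀ i, f (b i) ∈ Q i) :
    LinearIndependent K (fun t : {i // f (b i) ≠ 0} => f (b t.1)) := by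
  refine iSupIndep.linearIndependent (fun t : {i // f (b i) ≠ 0} => Q t.1) ?_ (fun t => hf t.1) (fun t => t.2)
  exact hQ.comp Subtype.val_injective

/-- BLOCK-KERNEL LEMMA: `ker f` is the span of the basis vectors killed by `f`. -/
theorem ker_eq_span_killed (b : Basis ι K V) (Q : ι → Submodule K W) (hQ : iSupIndep Q)
    (f : V →ₗ[K] W) (hf : ∀ i, f (b i) ∈ Q i) :
    LinearMap.ker f = span K (b '' {i | f (b i) = 0}) := by
  classical
  apply le_antisymm
  · intro v hv
    rw [LinearMap.mem_ker] at hv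
    rw [Basis.mem_span_image]
    -- expand `f v` along the basis
    have h1 : ∑ i ∈ (b.repr v).support, (b.repr v) i • f (b i) = 0 := by
      have h := congrArg f (b.linearCombination_repr v)
      rw [Finsupp.apply_linearCombination, Finsupp.linearCombination_apply] at h
      rw [hv] at h
      simpa [Finsupp.sum, Function.comp] using h
    -- drop the summands with `f (b i) = 0`
    have h2 : ∑ i ∈ (b.repr v).support with f (b i) ≠ 0, (b.repr v) i • f (b i) = 0 := by
      rw [Finset.sum_filter_of_ne]
      · exact h1
      · intro i _ hne hz
        exact hne (by rw [hz, smul_zero])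
    -- rewrite as a sum over the subtype and use linear independence
    have hli := linearIndependent_image_of_blocks b Q hQ f hf
    rw [← Finset.sum_subtype_eq_sum_filter] at h2
    have h4 := (linearIndependent_iff'.mp hli) _ (fun t => (b.repr v) t.1) h2
    intro i hi
    simp only [Finset.mem_coe, Finsupp.mem_support_iff] at hi
    simp only [Set.mem_setOf_eq]
    by_contra hne
    have := h4 ⟨i, hne⟩ (by simpa [Finset.mem_subtype] using hi)
    exact hi this
  · rw [span_le]
    rintro w ⟨i, hi, rfl⟩
    simpa using hi

/-- Hence `dim ker f` is the number of basis vectors killed by `f`. -/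
theorem finrank_ker_eq_card_killed [Fintype ι] (b : Basis ι K V) (Q : ι → Submodule K W) (hQ : iSupIndep Q)
    (f : V →ₗ[K] W) (hf : ∀ i, f (b i) ∈ Q i) [DecidablePred fun i => f (b i) = 0] :
    finrank K (LinearMap.ker f) = (Finset.univ.filter fun i => f (b i) = 0).card := by
  have himg : b '' {i | f (b i) = 0} = Set.range (fun z : {i // f (b i) = 0} => b z.1) := by
    ext w
    constructor
    · rintro ⟨i, hi, rfl⟩
      exact ⟨⟨i, hi⟩, rfl⟩
    · rintro ⟨⟨i, hi⟩, rfl⟩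
      exact ⟨i, hi, rfl⟩
  rw [ker_eq_span_killed b Q hQ f hf, himg]
  have hli : LinearIndependent K (fun z : {i // f (b i) = 0} => b z.1) :=
    b.linearIndependent.comp _ Subtype.val_injective
  rw [finrank_span_eq_card hli, Fintype.card_subtype]

/-- PENCIL FORM (the census's `e_t(λ)`): for two maps `Φ, Ψ` respecting the blocks, the kernel dimension of `c • Φ + Ψ` is the
number of basis vectors `b i` with `c • Φ (b i) + Ψ (b i) = 0`. -/
theorem finrank_ker_pencil_eq_card [Fintype ι] (b : Basis ι K V) (Q : ι → Submodule K W) (hQ : iSupIndep Q)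
    (Φ Ψ : V →ₗ[K] W) (hΦ : ∀ i, Φ (b i) ∈ Q i) (hΨ : ∀ i, Ψ (b i) ∈ Q i) (c : K)
    [DecidablePred fun i => c • Φ (b i) + Ψ (b i) = 0] :
    finrank K (LinearMap.ker (c • Φ + Ψ)) = (Finset.univ.filter fun i => c • Φ (b i) + Ψ (b i) = 0).card := by
  have hf : ∀ i, (c • Φ + Ψ) (b i) ∈ Q i := fun i => by
    simpa using (Q i).add_mem ((Q i).smul_mem c (hΦ i)) (hΨ i)
  have key := finrank_ker_eq_card_killed b Q hQ (c • Φ + Ψ) hf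
  simp only [LinearMap.add_apply, LinearMap.smul_apply] at key
  convert key using 2

/-- BLOCK STATES (the factor bookkeeping of THEOREM 1 (iv) for one block): inside a block, if `Φ (b i) = u` and `Ψ (b i) = w`,
the set of `c` with `c • u + w = 0` is everything when `u = 0 ∧ w = 0` ('F0G0'), empty when `u = 0, w ≠ 0`, and the single
value `c₀` with `c₀ • u = -w` when `u ≠ 0` — in particular at most one `c` unless the block is F0G0. -/
theorem block_alive_atMostOne {u w : W} (hu : u ≠ 0) {c c' : K} (hc : c • u + w = 0) (hc' : c' • u + w = 0) : c = c' := by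
  have h : (c - c') • u = 0 := by
    rw [sub_smul]
    have : c • u = c' • u := by
      have e1 : c • u = -w := eq_neg_of_add_eq_zero_left hc
      have e2 : c' • u = -w := eq_neg_of_add_eq_zero_left hc'
      rw [e1, e2]
    rw [this, sub_self]
  rcases smul_eq_zero.mp h with h0 | h0
  · exact sub_eq_zero.mp h0
  · exact absurd h0 hu

/-- PROPORTIONAL BLOCK: if `w = m • u` with `u ≠ 0` then the block dies exactly at `c = -m` … i.e. it is alive iff `c = -m`. -/
theorem block_alive_iff_of_prop {u : W} (hu : u ≠ 0) (m c : K) : c • u + m • u = 0 ↔ c = -m := by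
  constructor
  · intro h
    have h' : (c + m) • u = 0 := by rw [add_smul]; exact h
    rcases smul_eq_zero.mp h' with h0 | h0
    · exact eq_neg_of_add_eq_zero_left h0
    · exact absurd h0 hu
  · rintro rfl
    rw [neg_smul, neg_add_cancel]

end Summit.HodgeConjecture.HodgeConjecture.HodgeLocus.Census.BlockKernel
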